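import Literature.Barriers.Parity.LinearSieveOptimalityRemainder
import Literature.Barriers.Parity.LinearSieveOptimalityInduction
import HarnessLib

/-!
# `LinearSieveOptimality` — companion ("Proofs") file: discharge of `LinearSieveOptimality`

Topic `Literature/Barriers/Parity`, companion of the catalogue entry `LinearSieveOptimality.lean`
(D-0021 barrier: the linear sieve functions `F, f` are best possible — Selberg's extremal examples
attain them; Greaves, *Sieves in Number Theory* (2001), §4.5.1, Theorem 1), kept separate so that
the statement file and its light import graph are unchanged. Everything here is PROVED; no new
definitions, no named facts.

The statement file proves `LinearSieveOptimality` from Greaves' two displayed results,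
`Greaves2001_selbergSet_remainder` ((4.5.1.3): Selberg's sets have Selberg-type remainders) and
`Greaves2001_selbergSet_sifted` (Theorem 4.5.1.1: `S(𝒜^{(−)^r}(X), P(X^{1/s})) =
X V(P(X^{1/s}))(φ_r(s) + o(1))`), via `linearSieveOptimality_of_greaves`. Both facts are now
DISCHARGED in the tree:

* `Greaves2001_selbergSet_remainder_holds` (`LinearSieveOptimalityRemainder.lean`) — from the
  prime number theorem for Liouville's function with de la Vallée-Poussin's error term
  (`Literature.NumberTheory.LFunctions.abs_sum_liouville_le_mul_exp_neg_sqrt_log`, itself from the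
  tree's classical zero-free region for `ζ`);
* `Greaves2001_selbergSet_sifted_holds` (`LinearSieveOptimalityInduction.lean`) — Greaves'
  Buchstab induction (Lemma 4.5.1) from the Special Situation, with the prime number theorem,
  Mertens' theorems and the delay-differential equations of `F, f` (all proved in the tree).

Hence `LinearSieveOptimality_holds : LinearSieveOptimality`, unconditionally: there is a
regularity level `(c, K)` met by Selberg's sets `𝒜^± = {2X ≤ a < 4X : Ω(a) odd/even}` at which
every valid lower linear-sieve function `φ` satisfies `φ ≤ f` and every valid upper function `Φ`
satisfies `F ≤ Φ` on `[1, ∞)` ("when `κ = 1` the functions `F` and `f` are best possible").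

## References

* G. Greaves, *Sieves in Number Theory*, Springer (2001), pp. 80–81 and §4.5.1 (1.1)–(1.8),
  Theorem 1, Lemma 1 [Greaves2001] (held: `lit read book:greavesnd-sieves-number-theory`,
  PDF pp. 122–126).
* A. Selberg, *On elementary methods in primenumber-theory and their limitations*, 11. Skand.
  Mat. Kongress Trondheim 1949 (1952) [Selberg1952Limitations].
-/

noncomputable section

namespace Literature.Barriers.Parity

/-- **Discharge of the barrier `LinearSieveOptimality`** (Greaves 2001, Theorem 4.5.1.1 with
(4.5.1.3); Selberg 1949): the Jurkat–Richert / Rosser–Iwaniec functions `F, f` of the linear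
sieve are best possible — at the regularity level of Selberg's sets `𝒜^±`, every lower
linear-sieve function valid for all regular families is `≤ f` and every valid upper function is
`≥ F` on `[1, ∞)`. PROVED: `linearSieveOptimality_of_greaves` fed with the two discharged facts
`Greaves2001_selbergSet_remainder_holds` and `Greaves2001_selbergSet_sifted_holds`.
[cite: Greaves2001, pp. 80–81 and §4.5.1 Theorem 1] -/
theorem LinearSieveOptimality_holds : LinearSieveOptimality :=
  linearSieveOptimality_of_greaves Greaves2001_selbergSet_remainder_holds
    Greaves2001_selbergSet_sifted_holds

/-- The constants, unconditionally: at that regularity level a valid lower function vanishes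
(is `≤ 0`) on `[1, 2]` — the sifting limit `2` cannot be lowered — and a valid upper function is
`≥ A₁/s = 2e^γ/s` on `[1, 3]` — the Brun–Titchmarsh-type constant `2` cannot be reduced by the
linear sieve axioms alone (`LinearSieveOptimality.constants`). [cite: Greaves2001, p. 80 and §4.5.1] -/
theorem linearSieveOptimality_constants :
    ∃ c : ℝ, 0 < c ∧ ∃ K : ℝ, (∀ r : ℕ, IsSelbergRegular c K (selbergSet r)) ∧
      (∀ φ : ℝ → ℝ, IsLinearLowerSieveFun c K φ → ∀ s : ℝ, 1 ≤ s → s ≤ 2 → φ s ≤ 0) ∧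
      (∀ Φ : ℝ → ℝ, IsLinearUpperSieveFun c K Φ → ∀ s : ℝ, 1 ≤ s → s ≤ 3 →
        Literature.NumberTheory.Sieve.LinearSieve.const * s ^ (-(1 : ℝ)) ≤ Φ s) :=
  LinearSieveOptimality_holds.constants

end Literature.Barriers.Parity
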